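import Summits.Ventures.DiscreteObjects.Hadamard.CompositeOrderTable
import Summits.Ventures.DiscreteObjects.Hadamard.FixedSubmatrix41

/-!
# Hadamard 668 census, family F12 — the rank inequality for a general prime pair, and the exclusion of order 205 = 5·41 (kernel)

Framing: lottery ticket; floor = certified bounds/negative ranges.

Cell pub-namedobj (venture DiscreteObjects), target (H), hadamard gen 11.  `CompositeOrderRank.ineq_24type` (the Bessel–Burnside
orbit count on the block 'fixed rows × moved columns' of the `23`-part) is generalised to an arbitrary prime pair: for a
permutation automorphism pair `(π, κ)` with `π^(Pq) = κ^(Pq) = 1` (`P ≠ q` primes) whose `P`-part `(π^q, κ^q)` fixes `fP` rows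
and `fP` columns with the Gram identity `∑_{κ^q j ≠ j} H u j · H u' j = (668 − fP)·[u = u']` on the fixed rows, the inequality
`sum_card_fixed_le` evaluates to **`P·fP + (Pq − P)·f'_r ≤ (668 − fP) + (q − 1)·x₁`** (`ineq_block`), with
`f'_r = #(π^q-fixed ∩ π^P-fixed rows)` and `x₁ = #(κ^q-moved ∩ κ^P-fixed columns)`.
Application: **order `205 = 5·41` is impossible** (`no_hadamard668_signedAut_order205`): the `41`-part fixes `12 + 12`
(`hadamard668_signedAut_fixedRows`) with orthogonal fixed rows on the `656` moved columns (`hadamard_fixedRows_orth_of_card_lt`,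
`12 < 41`); counting (`counting_cols`, window for `5`, parity of the class number) forces `f' = 7`, `x₁ = 41` on rows and columns,
and `492 + 164·7 ≤ 656 + 4·41` fails.  With `CompositeOrderTable`: of the 45 products of two distinct odd primes of the spectrum,
32 are now excluded in the kernel; open by these methods: `15, 21, 33, 35, 39, 55, 65, 69, 77, 91, 111, 123, 143`.
Ours, not literature; no `sorry`.
-/

namespace Summit.Ventures.DiscreteObjects.Hadamard

open Finset BigOperators Matrix

open Literature.Combinatorics.Designs.GoethalsSeidel (IsHadamardMatrix)

variable {ι : Type*} [Fintype ι] [DecidableEq ι]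

section rankgen
variable {H : Matrix ι ι ℤ} {π κ : Equiv.Perm ι}

/-- counting below `P q`: multiples of `q`, non-multiples, zero, nonzero multiples of `P` -/
lemma count_multiples_gen {P q : ℕ} (hP0 : 0 < P) (hq0 : 0 < q) :
    (univ.filter fun m : Fin (P * q) => q ∣ m.val).card = P ∧
    (univ.filter fun m : Fin (P * q) => ¬ q ∣ m.val).card = P * q - P ∧
    (univ.filter fun m : Fin (P * q) => m.val = 0).card = 1 ∧
    (univ.filter fun m : Fin (P * q) => ¬ m.val = 0 ∧ P ∣ m.val).card = q - 1 := by
  haveI : NeZero (P * q) := ⟨(Nat.mul_pos hP0 hq0).ne'⟩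
  have c1 : (univ.filter fun m : Fin (P * q) => q ∣ m.val).card = P := card_fin_filter_dvd rfl hq0
  have c3 : (univ.filter fun m : Fin (P * q) => m.val = 0).card = 1 := card_fin_filter_eq_zero
  have cP : (univ.filter fun m : Fin (P * q) => P ∣ m.val).card = q := card_fin_filter_dvd (mul_comm P q) hP0
  refine ⟨c1, ?_, c3, ?_⟩
  · have hs := Finset.card_filter_add_card_filter_not (s := (univ : Finset (Fin (P * q)))) (fun m => q ∣ m.val)
    rw [Finset.card_univ, Fintype.card_fin, c1] at hs
    omega
  · have hs := card_filter_split (fun m : Fin (P * q) => P ∣ m.val) (fun m => m.val = 0)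
    have e1 : (univ.filter fun m : Fin (P * q) => P ∣ m.val ∧ m.val = 0) = univ.filter fun m => m.val = 0 :=
      Finset.filter_congr (fun m _ => ⟨fun h => h.2, fun h => ⟨by rw [h]; exact dvd_zero P, h⟩⟩)
    have e2 : (univ.filter fun m : Fin (P * q) => P ∣ m.val ∧ ¬ m.val = 0)
        = univ.filter fun m => ¬ m.val = 0 ∧ P ∣ m.val :=
      Finset.filter_congr (fun m _ => ⟨fun h => ⟨h.2, h.1⟩, fun h => ⟨h.2, h.1⟩⟩)
    rw [cP, e1, e2, c3] at hs
    omega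

/-- row side: for `m < Pq`, the rows fixed by `π^q` and `π^m` number `fP` if `q ∣ m` and `f'_r` otherwise -/
lemma card_fixedRows_pow_gen {P q fP : ℕ} (hP : P.Prime) (hq : q.Prime) (hPq : P ≠ q)
    (hf : (univ.filter fun i => (π ^ q) i = i).card = fP) (m : ℕ) :
    (univ.filter fun i => (π ^ q) i = i ∧ (π ^ m) i = i).card
      = if q ∣ m then fP else (univ.filter fun i => (π ^ q) i = i ∧ (π ^ P) i = i).card := by
  have hPq' : Nat.Coprime P q := (Nat.coprime_primes hP hq).mpr hPq
  split_ifs with hdvd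
  · rw [← hf]
    congr 1
    apply Finset.filter_congr
    intro i _
    exact ⟨And.left, fun hi => ⟨hi, pow_fixed_of_dvd π hdvd hi⟩⟩
  · congr 1
    apply Finset.filter_congr
    intro i _
    have hcop : Nat.Coprime m q := Nat.coprime_comm.mp ((Nat.Prime.coprime_iff_not_dvd hq).mpr hdvd)
    constructor
    · rintro ⟨hi, hm⟩
      exact ⟨hi, perm_pow_apply_of_fixed π (perm_fixed_of_pow_coprime π hcop hq.one_lt hm hi) P⟩
    · rintro ⟨hi, hm⟩
      exact ⟨hi, perm_pow_apply_of_fixed π (perm_fixed_of_pow_coprime π hPq' hq.one_lt hm hi) m⟩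

/-- column side: for `m < Pq`, the columns moved by `κ^q` and fixed by `κ^m` number `668 − fP` (`m = 0`), `x₁` (`P ∣ m ≠ 0`),
`0` otherwise -/
lemma card_movedCols_pow_gen (hι : Fintype.card ι = 668) {P q : ℕ} (hP : P.Prime) (hq : q.Prime)
    (hκ : κ ^ (P * q) = 1) (m : ℕ) (hm : m < P * q) :
    (univ.filter fun j => (κ ^ q) j ≠ j ∧ (κ ^ m) j = j).card
      = if m = 0 then 668 - (univ.filter fun j => (κ ^ q) j = j).card
        else if P ∣ m then (univ.filter fun j => (κ ^ q) j ≠ j ∧ (κ ^ P) j = j).card else 0 := by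
  have hκ1 : (κ ^ q) ^ P = 1 := by rw [← pow_mul, mul_comm]; exact hκ
  have hκ2 : (κ ^ P) ^ q = 1 := by rw [← pow_mul]; exact hκ
  split_ifs with h0 hPd
  · subst h0
    have hs := Finset.card_filter_add_card_filter_not (s := (univ : Finset ι)) (fun j => (κ ^ q) j = j)
    rw [Finset.card_univ, hι] at hs
    have e : (univ.filter fun j => (κ ^ q) j ≠ j ∧ (κ ^ 0) j = j) = univ.filter fun j => ¬ (κ ^ q) j = j := by
      apply Finset.filter_congr; intro j _; simp
    rw [e]
    omega
  · obtain ⟨m', rfl⟩ := hPd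
    have hm'pos : 0 < m' := by
      rcases Nat.eq_zero_or_pos m' with h | h
      · subst h; simp at h0
      · exact h
    have hm'lt : m' < q := by
      by_contra hc
      have : P * q ≤ P * m' := Nat.mul_le_mul_left P (not_lt.mp hc)
      omega
    have hcop : Nat.Coprime m' q :=
      Nat.coprime_comm.mp ((Nat.Prime.coprime_iff_not_dvd hq).mpr (Nat.not_dvd_of_pos_of_lt hm'pos hm'lt))
    congr 1
    apply Finset.filter_congr
    intro j _
    rw [pow_mul]
    have hbx : ((κ ^ P) ^ q) j = j := by rw [hκ2]; rfl
    exact and_congr_right fun _ => perm_pow_fixed_iff_of_coprime (κ ^ P) hcop hq.one_lt hbx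
  · rw [Finset.card_eq_zero, Finset.filter_eq_empty_iff]
    rintro j - ⟨hj, hjm⟩
    apply hj
    have hcop : Nat.Coprime m P := Nat.coprime_comm.mp ((Nat.Prime.coprime_iff_not_dvd hP).mpr hPd)
    have h1 : ((κ ^ q) ^ m) j = j := by
      rw [← pow_mul, mul_comm, pow_mul]
      exact perm_pow_apply_of_fixed _ hjm q
    have h2 : ((κ ^ q) ^ P) j = j := by rw [hκ1]; rfl
    exact perm_fixed_of_pow_coprime (κ ^ q) hcop hP.one_lt h1 h2

/-- **The rank inequality for a general prime pair.**  `P·fP + (Pq − P)·f'_r ≤ (668 − fP) + (q − 1)·x₁`, given the Gram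
identity of the `fP` fixed rows of the `P`-part on its moved columns. -/
lemma ineq_block (hι : Fintype.card ι = 668) (hA : ∀ i j, H (π i) (κ j) = H i j)
    {P q fP : ℕ} (hP : P.Prime) (hq : q.Prime) (hPq : P ≠ q) (hπ : π ^ (P * q) = 1) (hκ : κ ^ (P * q) = 1)
    (hfr : (univ.filter fun i => (π ^ q) i = i).card = fP) (hfc : (univ.filter fun j => (κ ^ q) j = j).card = fP)
    (hfP : fP < 668)
    (horth : ∀ u u' : ι, (π ^ q) u = u → (π ^ q) u' = u' →
      ∑ j ∈ univ.filter (fun j => (κ ^ q) j ≠ j), H u j * H u' j = if u = u' then ((668 - fP : ℕ) : ℤ) else 0) :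
    ((P : ℤ) * fP + (univ.filter fun i => (π ^ q) i = i ∧ (π ^ P) i = i).card * ((P : ℤ) * q - P) : ℤ)
      ≤ ((668 - fP : ℕ) : ℤ) + (univ.filter fun j => (κ ^ q) j ≠ j ∧ (κ ^ P) j = j).card * ((q : ℤ) - 1) := by
  haveI : NeZero (P * q) := ⟨(Nat.mul_pos hP.pos hq.pos).ne'⟩
  have hc : (0 : ℤ) < ((668 - fP : ℕ) : ℤ) := by exact_mod_cast (by omega : 0 < 668 - fP)
  -- the restricted permutations
  have hR : ∀ i, (π ^ q) (π i) = π i ↔ (π ^ q) i = i := by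
    intro i; rw [pow_apply_comm π q i]; exact π.apply_eq_iff_eq
  have hX : ∀ j, (κ ^ q) (κ j) ≠ κ j ↔ (κ ^ q) j ≠ j := by
    intro j; rw [pow_apply_comm κ q j]; exact not_congr κ.apply_eq_iff_eq
  set α : Equiv.Perm {i // (π ^ q) i = i} := π.subtypePerm hR with hαdef
  set β : Equiv.Perm {j // (κ ^ q) j ≠ j} := κ.subtypePerm hX with hβdef
  have hα : α ^ (P * q) = 1 := by ext x; simp [hαdef, Equiv.Perm.subtypePerm_pow, hπ]
  have hβ : β ^ (P * q) = 1 := by ext x; simp [hβdef, Equiv.Perm.subtypePerm_pow, hκ]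
  set M : Matrix {i // (π ^ q) i = i} {j // (κ ^ q) j ≠ j} ℤ := Matrix.of fun u x => H u.1 x.1 with hMdef
  have hM : M * Mᵀ = (((668 - fP : ℕ) : ℤ)) • (1 : Matrix {i // (π ^ q) i = i} {i // (π ^ q) i = i} ℤ) := by
    ext u u'
    rw [Matrix.mul_apply, Matrix.smul_apply, smul_eq_mul]
    simp only [Matrix.transpose_apply, hMdef, Matrix.of_apply]
    have e := horth u.1 u'.1 u.2 u'.2
    rw [Finset.sum_subtype (univ.filter fun j => (κ ^ q) j ≠ j) (p := fun j => (κ ^ q) j ≠ j) (fun j => by simp)]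
      at e
    rw [e, Matrix.one_apply]
    by_cases huu : u = u'
    · subst huu; simp
    · rw [if_neg (fun h => huu (Subtype.ext h)), if_neg huu, mul_zero]
  have heq : ∀ u x, M (α u) (β x) = M u x := by
    intro u x
    simp only [hMdef, hαdef, hβdef, Matrix.of_apply, Equiv.Perm.subtypePerm_apply]
    exact hA u.1 x.1
  have ineq := sum_card_fixed_le M hc hM α β hα hβ heq
  have eR : ∀ mm : Fin (P * q), ((univ.filter fun u : {i // (π ^ q) i = i} => (α ^ mm.val) u = u).card : ℤ)
      = if q ∣ mm.val then (fP : ℤ) else ((univ.filter fun i => (π ^ q) i = i ∧ (π ^ P) i = i).card : ℤ) := by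
    intro mm
    rw [hαdef, card_filter_subtypePerm_pow π (fun i => (π ^ q) i = i) hR mm.val,
      card_fixedRows_pow_gen hP hq hPq hfr mm.val]
    split_ifs <;> simp
  have eX : ∀ mm : Fin (P * q), ((univ.filter fun x : {j // (κ ^ q) j ≠ j} => (β ^ mm.val) x = x).card : ℤ)
      = if mm.val = 0 then (((668 - fP : ℕ) : ℤ)) else
          if P ∣ mm.val then ((univ.filter fun j => (κ ^ q) j ≠ j ∧ (κ ^ P) j = j).card : ℤ) else 0 := by
    intro mm
    rw [hβdef, card_filter_subtypePerm_pow κ (fun j => (κ ^ q) j ≠ j) hX mm.val,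
      card_movedCols_pow_gen hι hP hq hκ mm.val mm.2, hfc]
    split_ifs <;> simp
  rw [Finset.sum_congr rfl fun mm _ => eR mm, Finset.sum_congr rfl fun mm _ => eX mm] at ineq
  rw [Finset.sum_ite, Finset.sum_const, Finset.sum_const] at ineq
  rw [Finset.sum_ite, Finset.sum_const, Finset.sum_ite, Finset.sum_const, Finset.sum_const, Finset.filter_filter]
    at ineq
  obtain ⟨c1, c2, c3, c4⟩ := count_multiples_gen (P := P) (q := q) hP.pos hq.pos
  rw [c1, c2, c3, c4] at ineq
  simp only [nsmul_eq_mul, mul_zero, add_zero] at ineq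
  have hq2 : ((P * q - P : ℕ) : ℤ) = (P : ℤ) * q - P := by
    rw [Nat.cast_sub (Nat.le_mul_of_pos_right P hq.pos)]; push_cast; ring
  have hq1 : ((q - 1 : ℕ) : ℤ) = (q : ℤ) - 1 := by
    rw [Nat.cast_sub hq.one_lt.le]; push_cast; ring
  rw [hq1, hq2] at ineq
  simp only [Nat.cast_one, one_mul] at ineq
  linarith

end rankgen

section order205
variable {H : Matrix ι ι ℤ} {π κ : Equiv.Perm ι}

/-- `5 · 41`: the counting constraints force `x₁ = 41` and `f' = 7` -/
lemma arith_205 (W B fp m : ℕ) (h2 : 2 ∣ m) (hm : W + m * 5 = 668) (hlo : 112 ≤ m) (hhi : m ≤ 132)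
    (hs1 : 12 = (12 - fp) + fp) (hA : 5 ∣ 12 - fp) (hs2 : W = B + fp) (hB : 41 ∣ B) :
    B = 41 ∧ fp = 7 := by
  obtain ⟨t, rfl⟩ := h2
  obtain ⟨k, rfl⟩ := hB
  have hk : k ≤ 2 := by omega
  interval_cases k <;> omega

/-- **Order 205 (= 5 · 41), unsigned form: impossible.** -/
theorem no_unsignedAut_order205 (hH : IsHadamardMatrix H) (hι : Fintype.card ι = 668)
    (hA : ∀ i j, H (π i) (κ j) = H i j) (hπ : π ^ 205 = 1) (hκ : κ ^ 205 = 1)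
    (hσ : π ^ 5 ≠ 1 ∨ κ ^ 5 ≠ 1) (hh : π ^ 41 ≠ 1 ∨ κ ^ 41 ≠ 1) : False := by
  have hπ' : π ^ (41 * 5) = 1 := by rw [show (41 : ℕ) * 5 = 205 from rfl]; exact hπ
  have hκ' : κ ^ (41 * 5) = 1 := by rw [show (41 : ℕ) * 5 = 205 from rfl]; exact hκ
  have hπ'' : π ^ (5 * 41) = 1 := by rw [show (5 : ℕ) * 41 = 205 from rfl]; exact hπ
  have hκ'' : κ ^ (5 * 41) = 1 := by rw [show (5 : ℕ) * 41 = 205 from rfl]; exact hκ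
  -- the 41-part (π^5, κ^5): 12 + 12 fixed, Gram identity on moved columns
  have h5_41 : (π ^ 5) ^ 41 = 1 := by rw [← pow_mul]; exact hπ''
  have hk5_41 : (κ ^ 5) ^ 41 = 1 := by rw [← pow_mul]; exact hκ''
  obtain ⟨f12r, f12c, -⟩ := hadamard668_fixedSubmatrix_41 hH hι (π ^ 5) (κ ^ 5) _ _
    (isSignedAut_pow_of_unsigned hA 5) h5_41 hk5_41 hσ
  have horth : ∀ u u' : ι, (π ^ 5) u = u → (π ^ 5) u' = u' →
      ∑ j ∈ univ.filter (fun j => (κ ^ 5) j ≠ j), H u j * H u' j = if u = u' then ((668 - 12 : ℕ) : ℤ) else 0 := by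
    intro u u' hu hu'
    by_cases huu : u = u'
    · subst huu
      rw [if_pos rfl]
      have hmoved : (univ.filter fun j => (κ ^ 5) j ≠ j).card = 656 := by
        have h1 := Finset.card_filter_add_card_filter_not (s := (univ : Finset ι)) (fun j => (κ ^ 5) j = j)
        rw [Finset.card_univ, hι, f12c] at h1
        simp only [ne_eq]
        omega
      calc ∑ j ∈ univ.filter (fun j => (κ ^ 5) j ≠ j), H u j * H u j
          = ∑ j ∈ univ.filter (fun j => (κ ^ 5) j ≠ j), (1 : ℤ) :=
            Finset.sum_congr rfl fun j _ => pm_mul_self (hH.1 u j)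
        _ = _ := by rw [Finset.sum_const, nsmul_eq_mul, mul_one, hmoved]
    · rw [if_neg huu]
      exact (hadamard_fixedRows_orth_of_card_lt hH (π ^ 5) (κ ^ 5) _ _ (isSignedAut_pow_of_unsigned hA 5)
        (by norm_num) (by decide) hk5_41 (by omega) hu hu' huu).2
  -- counting, columns and rows
  obtain ⟨s1, dA, s2, dB, l1, l2⟩ := counting_cols κ (p := 5) (q := 41) (by norm_num) (by norm_num) hκ''
  obtain ⟨s1', dA', s2', dB', l1', l2'⟩ := counting_cols π (p := 5) (q := 41) (by norm_num) (by norm_num) hπ''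
  -- windows for the 5-part (π^41, κ^41)
  have h41_5 : (π ^ 41) ^ 5 = 1 := by rw [← pow_mul]; exact hπ'
  have hk41_5 : (κ ^ 41) ^ 5 = 1 := by rw [← pow_mul]; exact hκ'
  obtain ⟨h2, -, w5, -, -⟩ := hadamard668_signedAut_colClasses_window hH hι (p := 5) (by norm_num) (π ^ 41) (κ ^ 41) _ _
    (isSignedAut_pow_of_unsigned hA 41) h41_5 hk41_5 hh
  obtain ⟨hlo, hhi⟩ := w5 rfl
  have hcl := card_fixed_add_classes (κ ^ 41) (by norm_num : (5 : ℕ).Prime) hk41_5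
  rw [hι] at hcl
  obtain ⟨h2', -, w5', -, -⟩ := hadamard668_signedAut_rowClasses_window hH hι (p := 5) (by norm_num) (π ^ 41) (κ ^ 41) _ _
    (isSignedAut_pow_of_unsigned hA 41) h41_5 hk41_5 hh
  obtain ⟨hlo', hhi'⟩ := w5' rfl
  have hcl' := card_fixed_add_classes (π ^ 41) (by norm_num : (5 : ℕ).Prime) h41_5
  rw [hι] at hcl'
  -- arithmetic: x₁ = 41 (columns), f'_r = 7 (rows)
  rw [f12c] at s1 l1
  rw [f12r] at s1' l1'
  obtain ⟨hB, -⟩ := arith_205 _ _ _ _ h2 hcl hlo hhi (by omega) (by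
    have : (univ.filter fun j => (κ ^ 41) j ≠ j ∧ (κ ^ 5) j = j).card
        = 12 - (univ.filter fun j => (κ ^ 41) j = j ∧ (κ ^ 5) j = j).card := by omega
    rw [← this]; exact dA) s2 dB
  obtain ⟨-, hf'⟩ := arith_205 _ _ _ _ h2' hcl' hlo' hhi' (by omega) (by
    have : (univ.filter fun i => (π ^ 41) i ≠ i ∧ (π ^ 5) i = i).card
        = 12 - (univ.filter fun i => (π ^ 41) i = i ∧ (π ^ 5) i = i).card := by omega
    rw [← this]; exact dA') s2' dB'
  -- the rank inequality with P = 41, q = 5, fP = 12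
  have ineq := ineq_block hι hA (P := 41) (q := 5) (fP := 12) (by norm_num) (by norm_num) (by norm_num) hπ' hκ'
    f12r f12c (by norm_num) horth
  -- f'_r is the (π^5 ∧ π^41) count = the (π^41 ∧ π^5) count
  have ef : (univ.filter fun i => (π ^ 5) i = i ∧ (π ^ 41) i = i).card
      = (univ.filter fun i => (π ^ 41) i = i ∧ (π ^ 5) i = i).card := by
    congr 1; exact Finset.filter_congr (fun i _ => ⟨fun h => ⟨h.2, h.1⟩, fun h => ⟨h.2, h.1⟩⟩)
  rw [ef, hf', hB] at ineq
  exact absurd ineq (by norm_num)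

/-- **No Hadamard matrix of order 668 has a signed automorphism whose permutation pair has order divisible by `205 = 5·41`.** -/
theorem no_hadamard668_signedAut_order205 (hH : IsHadamardMatrix H) (hι : Fintype.card ι = 668)
    (π κ : Equiv.Perm ι) (d e : ι → ℤ) (haut : IsSignedAut H π κ d e)
    (hdvd : 5 * 41 ∣ orderOf ((π, κ) : Equiv.Perm ι × Equiv.Perm ι)) : False := by
  obtain ⟨π', κ', d', e', haut', h1, h2, h3, h4⟩ :=
    exists_pow_of_dvd_orderOf haut (by norm_num : (5 : ℕ).Prime) (by norm_num : (41 : ℕ).Prime) hdvd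
  obtain ⟨H', hH', hA⟩ := exists_unsigned_of_signedAut hH haut' (by decide : Odd (5 * 41)) h1 h2
  exact no_unsignedAut_order205 hH' hι hA h1 h2 h4 h3

end order205

end Summit.Ventures.DiscreteObjects.Hadamard
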